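import Summits.BirchSwinnertonDyer.BirchSwinnertonDyer.Theses.KatoDescentTamePotSupersingular
import Summits.BirchSwinnertonDyer.Rank1Residual.Additive.X4RankZeroKatoBoundTamagawaExact
import HarnessLib

/-!
# Route `KatoDescentTamePotSupersingular` (rung K8, sub-rung B4 (t′), cell `bsd-potss`): the crux
# `TameUpperDefectRankZero` (U₀, item stmt-BirchSwinnertonDyer-19982) LOSES ITS TAMAGAWA / MANIN DEFECT
# ROWS — the upper half on every irreducible TOWER-SURJECTIVE (t′) rank-`0` row from Kato's Tamagawa-exact
# reading (a `--supports` file; twin of the K9 file `KatoDescentPotSupersingularWildUpperDefectTowerSurj`)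

The route types its covered rows through the named fact A161
(`Kato2004.rankZero_padicValNat_sha_le_of_additive_potGood_of_imageContainsSL2`, with the Kim–Nakamura
binders `p ∤ Tam(E)` and a Manin datum). The tree also holds the Tamagawa-EXACT, Manin-FREE reading of
the same pages, A161″ (`Kato2004.rankZero_padicValNat_sha_add_padicValNat_tamagawa_le_of_additive_potGood_of_imageContainsSL2`,
implying A161), with the consumer `X4RankZero.missingUpperBoundAt_of_katoTam` at EVERY odd additive
potentially good `p`. Hence, granted A161″ + GZK + modularity, every irreducible (t′) row of analytic
rank `0` with surjective `p`-adic tower image has the upper half — no Tamagawa, no Manin binder; the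
irreducible defect rows of U₀ are only the tower-NON-surjective ones. The last theorem records the
reshaped composition of the crux. Conditional on the displayed named facts; the item is NOT closed.
Seat `bsd-potss-kmc` generation 6.

References: [Kato2004Asterisque] Thm. 14.5 (3) (p. 236), Prop. 14.16 (2) (p. 244), §14.8 (p. 238);
[GreenbergLNM1716] Prop. 4.13; [Miller2011LMS] Def. 1.1.
-/

set_option autoImplicit false
-- sibling precedent (`KatoDescentPotSupersingularAssembly.lean`): the directory name repeats the summit name
set_option linter.dupNamespace false

noncomputable section

open scoped Classical

namespace Summit.BirchSwinnertonDyer.BirchSwinnertonDyer.Theorems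

open WeierstrassCurve Literature.NumberTheory.EllipticCurves
  Literature.NumberTheory.EllipticCurves.ModularForms
  Literature.NumberTheory.EllipticCurves.Rank1Residual
  Literature.NumberTheory.EllipticCurves.Rank1Residual.Typed
  Summit.BirchSwinnertonDyer.Rank1Residual.Additive
  Summit.BirchSwinnertonDyer.Rank1Residual
  Summit.BirchSwinnertonDyer.BirchSwinnertonDyer.Theses.KatoDescentTamePotSupersingular

/-- **The upper half on EVERY irreducible tower-surjective (t′) rank-`0` row, Tamagawa- and Manin-free**
(granted A161″, GZK, modularity): `p` odd additive, `SubTprime W p`, `r_an = 0`, `ρ_{E,p^n}` onto for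
all `n` ⟹ `MissingUpperBoundAt W p`, by `X4RankZero.missingUpperBoundAt_of_katoTam` (`ClassX4` from
tower surjectivity at level `p¹`; `ord_p j ≥ 0` from `ClassO5`).
[cite: Kato2004Asterisque, Thm. 14.5 (3) (p. 236), Prop. 14.16 (2) (p. 244), §14.8 (p. 238)] [cite: GreenbergLNM1716, §4 Prop. 4.13] -/
theorem missingUpperBoundAt_tame_of_towerSurj_of_katoTam
    (hKatoT :
      Kato2004.rankZero_padicValNat_sha_add_padicValNat_tamagawa_le_of_additive_potGood_of_imageContainsSL2)
    (hGZK : rank_eq_analyticRank_of_analyticRank_le_one) (hmod : hasEntireLFunction_rat)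
    (W : WeierstrassCurve ℚ) [W.IsElliptic] [W.IsGloballyMinimal] (p : ℕ) [Fact p.Prime]
    (hr : W.analyticRank = 0) (hp2 : p ≠ 2) (hadd : Addv W p) (hT : SubTprime W p)
    (hsurj : ∀ n : ℕ, W.HasSurjectiveModNGaloisRep (p ^ n : ℕ)) : MissingUpperBoundAt W p := by
  haveI : NeZero (p : ℚ) := ⟨by exact_mod_cast (Fact.out : p.Prime).ne_zero⟩
  have hirr : W.HasIrreducibleModPGaloisRep p := by
    have h1 := hsurj 1
    simp only [pow_one] at h1
    exact hasIrreducibleModPGaloisRep_of_hasSurjectiveModNGaloisRep W p (by exact_mod_cast h1)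
  have hO5 : ClassO5 W p := ⟨hp2, hadd, Or.inr hT⟩
  exact X4RankZero.missingUpperBoundAt_of_katoTam W p hKatoT hGZK hmod hr ⟨hp2, hadd, hirr⟩
    hO5.padicValRat_j_nonneg hsurj

/-- **RESHAPED COMPOSITION of the crux `TameUpperDefectRankZero`** (for the route's tenure planner):
granted A161″ + GZK + modularity, U₀ on (t′) follows from (i) the upper half on the irreducible rows
whose `p`-adic tower image is NOT surjective and (ii) the upper half on the reducible defect rows
(a `ℤ/p²` member, or odd `ord_p #Ш_an`). Pure bookkeeping; nothing about (i), (ii) or the named facts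
is asserted. [cite: Kato2004Asterisque, Thm. 14.5 (3) (p. 236), Prop. 14.16 (2) (p. 244), §14.8 (p. 238)]
[cite: GreenbergLNM1716, §4 Prop. 4.13] -/
theorem tameUpperDefectRankZero_of_nonsurj_of_redDefect_of_katoTam
    (hKatoT :
      Kato2004.rankZero_padicValNat_sha_add_padicValNat_tamagawa_le_of_additive_potGood_of_imageContainsSL2)
    (hGZK : rank_eq_analyticRank_of_analyticRank_le_one) (hmod : hasEntireLFunction_rat)
    (hns : ∀ (W : WeierstrassCurve ℚ) [W.IsElliptic] [W.IsGloballyMinimal] (p : ℕ) [Fact p.Prime],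
      W.analyticRank = 0 → p ≠ 2 → Addv W p → SubTprime W p → W.HasIrreducibleModPGaloisRep p →
      ¬ (∀ n : ℕ, W.HasSurjectiveModNGaloisRep (p ^ n : ℕ)) → MissingUpperBoundAt W p)
    (hred : ∀ (W : WeierstrassCurve ℚ) [W.IsElliptic] [W.IsGloballyMinimal] (p : ℕ) [Fact p.Prime],
      W.analyticRank = 0 → p ≠ 2 → Addv W p → SubTprime W p → ¬ W.HasIrreducibleModPGaloisRep p →
      ¬ ((∀ (W' : WeierstrassCurve ℚ) [W'.IsElliptic], IsIsogenous W W' → ¬ p ^ 2 ∣ W'.torsionOrder) ∧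
          ∀ q : ℚ, shaAn W = (q : ℂ) → Even (padicValRat p q)) →
      MissingUpperBoundAt W p) :
    Summit.BirchSwinnertonDyer.BirchSwinnertonDyer.Theses.KatoDescentTamePotSupersingular.TameUpperDefectRankZero := by
  intro W _ _ p _ hr hp2 hadd hT hcov
  by_cases hI : W.HasIrreducibleModPGaloisRep p
  · by_cases hsurj : ∀ n : ℕ, W.HasSurjectiveModNGaloisRep (p ^ n : ℕ)
    · exact missingUpperBoundAt_tame_of_towerSurj_of_katoTam hKatoT hGZK hmod W p hr hp2 hadd hT hsurj
    · exact hns W p hr hp2 hadd hT hI hsurj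
  · exact hred W p hr hp2 hadd hT hI (fun h ↦ hcov (Or.inr ⟨hI, h⟩))

end Summit.BirchSwinnertonDyer.BirchSwinnertonDyer.Theorems

end
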